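import Mathlib
import Summits.ValiantsHypothesis.ValiantsHypothesis.Theorems.NewtonUnitEquationsTwoProductsPowerSumCriterion
import Summits.ValiantsHypothesis.ValiantsHypothesis.Theorems.NewtonUnitEquationsTwoProductsFormalLogLinearisationDefs
import Summits.ValiantsHypothesis.ValiantsHypothesis.Theorems.NewtonUnitEquationsTwoProductsFormalLogLinearisationTame

/-!
# Crux `TwoProducts` (stmt-ValiantsHypothesis-5906), line `formal-log-linearisation`: STUB 3 `stub_logLinearisation`

The registered line `Cruxes/TwoProducts/Lines/formal-log-linearisation.lean` (NOT the item's skeleton of record)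
reduces the crux `TwoProducts` to a count of weight-visible points of the support of a signed sum of formal
logarithms. Its STUB 3 (`stub_logLinearisation`, "M/L, provable now") is the transport identity: for a normalised
instance `(u, v)` (tails with zero constant term) and a VALID REAL WEIGHT `ξ` (negative on every tail exponent),

  `l` is the strict `ξ`-top of `supp (∏ (1 + u_j) − ∏ (1 + v_j))`  iff
  `l` is the strict `ξ`-top of `supp D`,  `D = Σ_j log (1 + u_j) − Σ_j log (1 + v_j)`

(`supp D` = the line's `logSupport`, an infinite set in general, with the coefficients `logDiff` written as
exact finite truncations).  This file proves it VERBATIM over the objects of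
`Theorems/NewtonUnitEquationsTwoProductsFormalLogLinearisationDefs.lean` (= the line's objects, same names and
bodies).

## Proof

No power series are used.  The landed finite-order engine of the sibling line `corner-log-linearization`,
`Theorems.TwoProducts.PowerSum.coeff_wronskian_congr` (file `…TwoProductsPowerSumCriterion.lean`), gives for ANY
derivation `θ` and the order-`R` truncation `Λ_R = Σ_{r=1}^{R} ((−1)^{r+1}/r) • (Σ_i u_i^r − Σ_i v_i^r)` the
congruence `θF·Q − F·θQ ≡ P·Q·θΛ_R` below TOTAL DEGREE `R` (`P = ∏(1+u)`, `Q = ∏(1+v)`, `F = P − Q`).  We take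
`θ = θ_ξ`, the complex Euler derivation of the real weight (`coeff q (θ_ξ A) = wt ξ q · coeff q A`), and transport
"strict `ξ`-top" along the chain

  `supp F = supp θF ~ supp (θF·Q − F·θQ) ≈ supp (P·Q·θΛ_R) ~ supp θΛ_R = supp Λ_R ≈ logSupport`

with the two elementary principles of `…FormalLogLinearisationTame.lean`: (`~`, `isStrictTop_support_add_iff`)
adding a polynomial all of whose support points lie STRICTLY BELOW support points of `A` does not change the
strict top; (`≈`, `isStrictTop_congr`) two sets that agree at and above the weight of `l` have the same strict-top
status at `l`.  The agreement comes from TAMENESS: everything in sight is supported in the cone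
`{p : c·(p₀+p₁) ≤ −wt ξ p}` for one `c > 0` (`exists_tame_const`), on which the weight is negative away from `0` and
the total degree is `≤ −wt ξ l / c < R := ⌈−wt ξ l / c⌉₊ + 1` at or above the weight of `l`; and
`coeff n Λ_R = logDiff u v n` for `n₀ + n₁ ≤ R` (`coeff_logTrunc_eq_logDiff`).

Honest framing: a transport stub of a registered non-record line; the line's open engine `stub_logSumEngine` and
the crux `TwoProducts` are untouched and OPEN; nothing here bears on `VP ≠ VNP`.
-/

set_option linter.dupNamespace false

noncomputable section

open scoped BigOperators
open MvPolynomial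

namespace Summit.ValiantsHypothesis.ValiantsHypothesis.Theorems.NewtonUnitEquations.TwoProducts.FormalLogLinearisation

variable {m : ℕ}

/-! ## The truncated log-sum and the line's `logDiff` -/

/-- Coefficients of the order-`R` truncation `Λ_R = Σ_{r=1}^{R} ((−1)^{r+1}/r) • (Σ_i u_i^r − Σ_i v_i^r)` of the
log-sum agree with the line's `logDiff` at every exponent of total degree `≤ R` (the line's `logCoeff` truncates
at the total degree, which is exact since `u^r` has no monomial of total degree `< r`). [folklore] -/
theorem coeff_logTrunc_eq_logDiff (u v : Fin m → MvPolynomial (Fin 2) ℂ) (hu : ∀ j, coeff 0 (u j) = 0)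
    (hv : ∀ j, coeff 0 (v j) = 0) (R : ℕ) (n : Expo) (hn : n 0 + n 1 ≤ R) :
    coeff n (∑ r ∈ Finset.Icc 1 R, ((-1 : ℂ) ^ (r + 1) / (r : ℂ)) • (∑ i, u i ^ r - ∑ i, v i ^ r)) =
      logDiff u v n := by
  -- the total-degree weight for `coeff_pow_eq_zero_below`
  have hadd : ∀ p q : Expo,
      (1 : ℤ) * (((p + q) 0 : ℕ) : ℤ) + 1 * (((p + q) 1 : ℕ) : ℤ) =
        (1 * ((p 0 : ℕ) : ℤ) + 1 * ((p 1 : ℕ) : ℤ)) + (1 * ((q 0 : ℕ) : ℤ) + 1 * ((q 1 : ℕ) : ℤ)) := by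
    intro p q
    simp only [Finsupp.coe_add, Pi.add_apply]
    push_cast
    ring
  have hpos := TwoProducts.PowerSum.one_le_wt_of_ne_zero (fun _ : Fin 2 => (1 : ℤ)) one_pos one_pos
  have hvanish : ∀ (h : MvPolynomial (Fin 2) ℂ), coeff 0 h = 0 → ∀ r, n 0 + n 1 < r → coeff n (h ^ r) = 0 := by
    intro h h0 r hr
    exact TwoProducts.PowerSum.coeff_pow_eq_zero_below _ hadd hpos h h0 r n (by omega)
  have hsub : Finset.Icc 1 (n 0 + n 1) ⊆ Finset.Icc 1 R := by
    intro r hr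
    rw [Finset.mem_Icc] at hr ⊢
    omega
  have hkey : ∀ (h : MvPolynomial (Fin 2) ℂ), coeff 0 h = 0 →
      ∑ r ∈ Finset.Icc 1 R, (-1 : ℂ) ^ (r + 1) / (r : ℂ) * coeff n (h ^ r) = logCoeff h n := by
    intro h h0
    unfold logCoeff
    refine (Finset.sum_subset hsub fun r hr hr' => ?_).symm
    have hlt : n 0 + n 1 < r := by
      rw [Finset.mem_Icc] at hr hr'
      omega
    rw [hvanish h h0 r hlt, mul_zero]
  simp only [coeff_sum, coeff_smul, coeff_sub, smul_eq_mul, mul_sub, Finset.mul_sum, Finset.sum_sub_distrib]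
  rw [Finset.sum_comm, Finset.sum_comm (s := Finset.Icc 1 R)]
  unfold logDiff
  congr 1
  · exact Finset.sum_congr rfl fun j _ => hkey (u j) (hu j)
  · exact Finset.sum_congr rfl fun j _ => hkey (v j) (hv j)

/-- The line's `logSupport` is tame: a point of `supp D` is a support point of some `u_j^r` or `v_j^r`, `r ≥ 1`.
[folklore] -/
theorem tame_logSupport (ξ : Fin 2 → ℝ) (c : ℝ) (u v : Fin m → MvPolynomial (Fin 2) ℂ)
    (hu : ∀ j, ∀ p ∈ (u j).support, c * (((p 0 : ℕ) : ℝ) + ((p 1 : ℕ) : ℝ)) ≤ -wt ξ p)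
    (hv : ∀ j, ∀ p ∈ (v j).support, c * (((p 0 : ℕ) : ℝ) + ((p 1 : ℕ) : ℝ)) ≤ -wt ξ p) :
    ∀ p ∈ logSupport u v, c * (((p 0 : ℕ) : ℝ) + ((p 1 : ℕ) : ℝ)) ≤ -wt ξ p := by
  intro p hp
  have hp' : logDiff u v p ≠ 0 := hp
  unfold logDiff at hp'
  by_contra hbad
  have hzero : ∀ (h : MvPolynomial (Fin 2) ℂ),
      (∀ q ∈ h.support, c * (((q 0 : ℕ) : ℝ) + ((q 1 : ℕ) : ℝ)) ≤ -wt ξ q) → logCoeff h p = 0 := by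
    intro h hh
    unfold logCoeff
    refine Finset.sum_eq_zero fun r _ => ?_
    have : coeff p (h ^ r) = 0 := by
      by_contra hne
      exact hbad (tame_pow ξ c hh r p (mem_support_iff.mpr hne))
    rw [this, mul_zero]
  apply hp'
  rw [Finset.sum_eq_zero fun j _ => hzero (u j) (hu j), Finset.sum_eq_zero fun j _ => hzero (v j) (hv j),
    sub_self]

/-! ## STUB 3 -/

/-- **STUB 3 of line `formal-log-linearisation` (`stub_logLinearisation`), verbatim**: for a normalised instance
and a valid real weight `ξ`, a point is the strict `ξ`-top of `supp(∏(1+u) − ∏(1+v))` iff it is the strict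
`ξ`-top of the support of the log-sum `D = Σ_j log(1+u_j) − Σ_j log(1+v_j)`. [folklore] -/
theorem stub_logLinearisation :
    ∀ (m : ℕ) (u v : Fin m → MvPolynomial (Fin 2) ℂ), (∀ j, coeff 0 (u j) = 0) → (∀ j, coeff 0 (v j) = 0) →
      ∀ ξ : Fin 2 → ℝ, ValidWeight u v ξ →
        ∀ l : Expo, IsStrictTop ξ ↑(tailDiff u v).support l ↔ IsStrictTop ξ (logSupport u v) l := by
  classical
  intro m u v hu hv ξ hξ l
  -- (0) a uniform tameness constant for all tails
  obtain ⟨c, hc, hcT⟩ := exists_tame_const ξ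
    ((Finset.univ.biUnion fun j => (u j).support) ∪ (Finset.univ.biUnion fun j => (v j).support))
    (by
      intro e he
      rcases Finset.mem_union.mp he with he | he
      · obtain ⟨j, -, hj⟩ := Finset.mem_biUnion.mp he
        exact hξ.1 j e hj
      · obtain ⟨j, -, hj⟩ := Finset.mem_biUnion.mp he
        exact hξ.2 j e hj)
  have hut : ∀ j, ∀ p ∈ (u j).support, c * (((p 0 : ℕ) : ℝ) + ((p 1 : ℕ) : ℝ)) ≤ -wt ξ p :=
    fun j p hp => hcT p (Finset.mem_union_left _ (Finset.mem_biUnion.mpr ⟨j, Finset.mem_univ j, hp⟩))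
  have hvt : ∀ j, ∀ p ∈ (v j).support, c * (((p 0 : ℕ) : ℝ) + ((p 1 : ℕ) : ℝ)) ≤ -wt ξ p :=
    fun j p hp => hcT p (Finset.mem_union_right _ (Finset.mem_biUnion.mpr ⟨j, Finset.mem_univ j, hp⟩))
  -- names
  set P : MvPolynomial (Fin 2) ℂ := ∏ j, (1 + u j) with hP
  set Q : MvPolynomial (Fin 2) ℂ := ∏ j, (1 + v j) with hQ
  set F : MvPolynomial (Fin 2) ℂ := P - Q with hF
  have hFdef : tailDiff u v = F := rfl
  set D := MvPolynomial.mkDerivation ℂ (fun i : Fin 2 => ((ξ i : ℝ) : ℂ) • (X i : MvPolynomial (Fin 2) ℂ))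
    with hD
  have hDc : ∀ A q, coeff q (D A) = ((wt ξ q : ℝ) : ℂ) * coeff q A := coeff_eulerDerivation_wt ξ
  set R : ℕ := ⌈-wt ξ l / c⌉₊ + 1 with hR
  set Λ : MvPolynomial (Fin 2) ℂ :=
    ∑ r ∈ Finset.Icc 1 R, ((-1 : ℂ) ^ (r + 1) / (r : ℂ)) • (∑ i, u i ^ r - ∑ i, v i ^ r) with hΛ
  -- (1) tameness of everything in sight
  have hPt : ∀ p ∈ P.support, c * (((p 0 : ℕ) : ℝ) + ((p 1 : ℕ) : ℝ)) ≤ -wt ξ p :=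
    tame_prod ξ c _ fun j _ => tame_add ξ c (tame_one ξ c) (hut j)
  have hQt : ∀ p ∈ Q.support, c * (((p 0 : ℕ) : ℝ) + ((p 1 : ℕ) : ℝ)) ≤ -wt ξ p :=
    tame_prod ξ c _ fun j _ => tame_add ξ c (tame_one ξ c) (hvt j)
  have hFt : ∀ p ∈ F.support, c * (((p 0 : ℕ) : ℝ) + ((p 1 : ℕ) : ℝ)) ≤ -wt ξ p := tame_sub ξ c hPt hQt
  have hΛt : ∀ p ∈ Λ.support, c * (((p 0 : ℕ) : ℝ) + ((p 1 : ℕ) : ℝ)) ≤ -wt ξ p :=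
    tame_sum ξ c _ fun r _ => tame_smul ξ c _
      (tame_sub ξ c (tame_sum ξ c _ fun i _ => tame_pow ξ c (hut i) r)
        (tame_sum ξ c _ fun i _ => tame_pow ξ c (hvt i) r))
  -- constant terms
  have hP0 : coeff 0 P = 1 :=
    TwoProducts.PowerSum.coeff_zero_prod_eq_one (fun j => 1 + u j) fun j => by
      rw [coeff_add, coeff_zero_one, hu j, add_zero]
  have hQ0 : coeff 0 Q = 1 :=
    TwoProducts.PowerSum.coeff_zero_prod_eq_one (fun j => 1 + v j) fun j => by
      rw [coeff_add, coeff_zero_one, hv j, add_zero]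
  have hF0 : coeff 0 F = 0 := by rw [hF, coeff_sub, hP0, hQ0, sub_self]
  have hΛ0 : coeff 0 Λ = 0 := by
    have h := TwoProducts.PowerSum.coeff_zero_logTrunc (fun j => 1 + u j) (fun j => 1 + v j)
      (fun j => by rw [coeff_add, coeff_zero_one, hu j, add_zero])
      (fun j => by rw [coeff_add, coeff_zero_one, hv j, add_zero]) R
    simpa only [add_sub_cancel_left] using h
  -- (2) the Wronskian congruence below total degree `R` (landed `PowerSum.coeff_wronskian_congr`)
  have hadd : ∀ p q : Expo,
      (1 : ℤ) * (((p + q) 0 : ℕ) : ℤ) + 1 * (((p + q) 1 : ℕ) : ℤ) =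
        (1 * ((p 0 : ℕ) : ℤ) + 1 * ((p 1 : ℕ) : ℤ)) + (1 * ((q 0 : ℕ) : ℤ) + 1 * ((q 1 : ℕ) : ℤ)) := by
    intro p q
    simp only [Finsupp.coe_add, Pi.add_apply]
    push_cast
    ring
  have hpos := TwoProducts.PowerSum.one_le_wt_of_ne_zero (fun _ : Fin 2 => (1 : ℤ)) one_pos one_pos
  have hcong : ∀ p : Expo, (1 : ℤ) * ((p 0 : ℕ) : ℤ) + 1 * ((p 1 : ℕ) : ℤ) < (R : ℤ) →
      coeff p (D F * Q - F * D Q) = coeff p (P * Q * D Λ) := by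
    have h := TwoProducts.PowerSum.coeff_wronskian_congr
      (fun p : Expo => (1 : ℤ) * ((p 0 : ℕ) : ℤ) + 1 * ((p 1 : ℕ) : ℤ)) hadd hpos D
      (fun j => 1 + u j) (fun j => 1 + v j)
      (fun j => by rw [coeff_add, coeff_zero_one, hu j, add_zero])
      (fun j => by rw [coeff_add, coeff_zero_one, hv j, add_zero]) R
    simpa only [add_sub_cancel_left] using h
  -- (3) degree bound: tame points at or above the weight of `l` have total degree `< R`
  have hdeg : ∀ p : Expo, c * (((p 0 : ℕ) : ℝ) + ((p 1 : ℕ) : ℝ)) ≤ -wt ξ p → wt ξ l ≤ wt ξ p →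
      (p 0 + p 1 : ℕ) < R := by
    intro p hp hle
    have h1 : ((p 0 : ℕ) : ℝ) + ((p 1 : ℕ) : ℝ) ≤ -wt ξ l / c := deg_le_of_tame hc hp hle
    have h2 : -wt ξ l / c ≤ (⌈-wt ξ l / c⌉₊ : ℝ) := Nat.le_ceil _
    have h3 : ((p 0 + p 1 : ℕ) : ℝ) ≤ (⌈-wt ξ l / c⌉₊ : ℝ) := by push_cast; linarith
    have h4 : p 0 + p 1 ≤ ⌈-wt ξ l / c⌉₊ := by exact_mod_cast h3
    omega
  -- (4) the chain of transfers
  have step1 : IsStrictTop ξ ↑F.support l ↔ IsStrictTop ξ ↑(D F).support l := by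
    rw [support_euler_eq ξ hc (hDc F) hF0 hFt]
  have step2 : IsStrictTop ξ ↑(D F).support l ↔ IsStrictTop ξ ↑(D F * Q - F * D Q).support l := by
    have hsplit : D F * Q - F * D Q = D F + (D F * (Q - 1) - F * D Q) := by ring
    rw [hsplit]
    refine (isStrictTop_support_add_iff ξ (D F) (D F * (Q - 1) - F * D Q) (fun p hp => ?_) l).symm
    rcases Finset.mem_union.mp (support_sub _ _ _ hp) with h | h
    · exact below_of_support_mul ξ hc (D F) (Q - 1) (by rw [coeff_sub, hQ0, coeff_zero_one, sub_self])
        (tame_sub ξ c hQt (tame_one ξ c)) p h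
    · obtain ⟨q, hq, hlt⟩ := below_of_support_mul ξ hc F (D Q)
        (by rw [hDc, wt_zero]; simp) (tame_euler ξ c (hDc Q) hQt) p h
      exact ⟨q, by rwa [support_euler_eq ξ hc (hDc F) hF0 hFt], hlt⟩
  have step3 : IsStrictTop ξ ↑(D F * Q - F * D Q).support l ↔ IsStrictTop ξ ↑(P * Q * D Λ).support l := by
    refine isStrictTop_congr ξ fun p hle => ?_
    have hXt : ∀ p ∈ (D F * Q - F * D Q).support, c * (((p 0 : ℕ) : ℝ) + ((p 1 : ℕ) : ℝ)) ≤ -wt ξ p :=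
      tame_sub ξ c (tame_mul ξ c (tame_euler ξ c (hDc F) hFt) hQt) (tame_mul ξ c hFt (tame_euler ξ c (hDc Q) hQt))
    have hYt : ∀ p ∈ (P * Q * D Λ).support, c * (((p 0 : ℕ) : ℝ) + ((p 1 : ℕ) : ℝ)) ≤ -wt ξ p :=
      tame_mul ξ c (tame_mul ξ c hPt hQt) (tame_euler ξ c (hDc Λ) hΛt)
    simp only [Finset.mem_coe, mem_support_iff]
    by_cases hp : coeff p (D F * Q - F * D Q) ≠ 0 ∨ coeff p (P * Q * D Λ) ≠ 0
    · have htame : c * (((p 0 : ℕ) : ℝ) + ((p 1 : ℕ) : ℝ)) ≤ -wt ξ p := by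
        rcases hp with hp | hp
        · exact hXt p (mem_support_iff.mpr hp)
        · exact hYt p (mem_support_iff.mpr hp)
      have hR' := hdeg p htame hle
      rw [hcong p (by omega)]
    · push Not at hp
      simp [hp.1, hp.2]
  have step4 : IsStrictTop ξ ↑(P * Q * D Λ).support l ↔ IsStrictTop ξ ↑(D Λ).support l := by
    have hsplit : P * Q * D Λ = D Λ + D Λ * (P * Q - 1) := by ring
    rw [hsplit]
    refine isStrictTop_support_add_iff ξ (D Λ) (D Λ * (P * Q - 1)) (fun p hp => ?_) l
    exact below_of_support_mul ξ hc (D Λ) (P * Q - 1)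
      (by rw [coeff_sub, coeff_zero_one, coeff_mul]; simp [hP0, hQ0])
      (tame_sub ξ c (tame_mul ξ c hPt hQt) (tame_one ξ c)) p hp
  have step5 : IsStrictTop ξ ↑(D Λ).support l ↔ IsStrictTop ξ ↑Λ.support l := by
    rw [support_euler_eq ξ hc (hDc Λ) hΛ0 hΛt]
  have step6 : IsStrictTop ξ ↑Λ.support l ↔ IsStrictTop ξ (logSupport u v) l := by
    refine isStrictTop_congr ξ fun p hle => ?_
    simp only [Finset.mem_coe, mem_support_iff]
    show coeff p Λ ≠ 0 ↔ logDiff u v p ≠ 0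
    by_cases hp : coeff p Λ ≠ 0 ∨ logDiff u v p ≠ 0
    · have htame : c * (((p 0 : ℕ) : ℝ) + ((p 1 : ℕ) : ℝ)) ≤ -wt ξ p := by
        rcases hp with hp | hp
        · exact hΛt p (mem_support_iff.mpr hp)
        · exact tame_logSupport ξ c u v hut hvt p hp
      have hR' := hdeg p htame hle
      rw [hΛ, coeff_logTrunc_eq_logDiff u v hu hv R p (by omega)]
    · push Not at hp
      simp [hp.1, hp.2]
  rw [hFdef]
  exact step1.trans (step2.trans (step3.trans (step4.trans (step5.trans step6))))

end Summit.ValiantsHypothesis.ValiantsHypothesis.Theorems.NewtonUnitEquations.TwoProducts.FormalLogLinearisation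

end
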